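import Literature.Analysis.FluidPDE.PeriodicSwirlEnergy
import Literature.Analysis.FluidPDE.LeiZhang2011EnergyAxis
import HarnessLib

/-!
# Lei–Ren–Zhang 2019, §3: the localized energy identity per period with the axis term

Analysis/FluidPDE proofs file (theorems only, no definitions, no named facts), on the discharge
path of the named fact `Literature.Analysis.FluidPDE.leiRenZhang2019_liouville_periodic`
(Z. Lei, X. Ren, Q. S. Zhang, arXiv:1902.11229 = Math. Ann. 383 (2022), Theorem 1.1). In §3
(arXiv pp. 7–9) the swirl-type equation `∂ₜΦ + b·∇Φ + (2/r)∂ᵣΦ = ΔΦ` is tested, for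
`Ψ = −ln Φ` (Lemma 3.1, (3.3)) and for `√Φ` (Lemma 3.3, (3.13)), against the square of the
`z`-independent radial cut-off `ζ_R(r)` of (3.2) and integrated over ONE period
`D_R = {r < R} × [0, Z₀)`; the solution is a nonzero constant on the axis, so the axis term
`(2/r)∂ᵣ` produces the boundary contribution "`2∬(Ψ − Ψ̄)ζ_R² dθ dz|_{r=0}`" of (3.7) /
"`−2∭√Φ|_{r=0}ψ² dθ dz dt`" of (3.14).

This file records that identity in the tree's `H`-calculus — the periodic twin of
`LeiZhang2011.energy_identity_axis` — by the window device of `PeriodicSwirlEnergy`: the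
whole-space identity is applied to the compactly supported cut-off `φ̃(x) = ψ(x)ω(x₂)`
(`ω = periodicWindow P`, `Σ_k ω(· + kP)² = 1`), and every term is a slab integral of
period-independent data plus an `(ω²)′`-term that vanishes by periodicity.

* `integral_mul_periodicWindow_sq_real` — the window identity on the axis:
  `∫_ℝ f ω² = ∫_0^P f` for a continuous `P`-periodic `f`;
* `energy_identity_axis_divFree` — `LeiZhang2011.energy_identity_axis` for a `C¹`
  divergence-free drift (instead of `b = curl B`), any axisymmetric `φ ∈ C²_c`;
* `energy_identity_axis_periodic` — the identity per period: for `F(s,·)`, `b(s,·)` axially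
  `P`-periodic, `ψ ∈ C²` axisymmetric, `z`-independent, `= 1` on `{r ≤ ρ'}`, `= 0` on `{r ≥ ρ}`,
  `∫_{zSlab P 0} (H(F(t₂))η(t₂) − H(F(t₁))η(t₁)) ψ² = ∫_{t₁}^{t₂} ( η [ −∫_{slab}(H''(F)‖∇F‖²ψ² + H'(F)⟪∇F,∇ψ²⟫)`
  `  + ∫_{slab} H(F)⟪b,∇ψ²⟫ + ∫_{slab} (2/r)H(F)∂ᵣψ² + 2c₂ ψ(0)² ∫_0^P H(F(s,(0,0,z))) dz ] + η' ∫_{slab} H(F)ψ² ) ds`.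

## References

* Z. Lei, X. Ren, Q. S. Zhang, arXiv:1902.11229, §3 (3.3)–(3.8) and (3.13)–(3.14) (arXiv pp. 7–9).
  [LeiRenZhang2019]
* Z. Lei, Q. S. Zhang, J. Funct. Anal. 261 (2011) = arXiv:1011.5066, proofs of Lemmas 3.2, 3.4
  (the axis boundary terms; tree `LeiZhang2011EnergyAxis`). [LeiZhang2011]
-/

noncomputable section

open MeasureTheory Set Function Filter Metric intervalIntegral
open _root_.Topology
open scoped InnerProductSpace RealInnerProductSpace NNReal ENNReal Laplacian

namespace Literature.Analysis.FluidPDE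

namespace LeiRenZhang2019

open LeiZhang2011

/-! ### Plumbing -/

/-- Unfolding of axial periodicity with `eZ`. [folklore] -/
private theorem periodic_apply_pea {α : Sort*} {P : ℝ} {Q : EuclideanSpace ℝ (Fin 3) → α}
    (hQ : IsAxiallyPeriodic P Q) (x : EuclideanSpace ℝ (Fin 3)) : Q (x + P • eZ) = Q x :=
  hQ x

/-- Axial periodicity from its `eZ` form. [folklore] -/
private theorem periodic_of_eZ_pea {α : Sort*} {P : ℝ} {Q : EuclideanSpace ℝ (Fin 3) → α}
    (hQ : ∀ x : EuclideanSpace ℝ (Fin 3), Q (x + P • eZ) = Q x) : IsAxiallyPeriodic P Q :=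
  hQ

/-- A function invariant under all axial translations is axially periodic. [folklore] -/
private theorem periodic_of_forall_add_smul_pea {α : Sort*} {P : ℝ} {c : EuclideanSpace ℝ (Fin 3) → α}
    (hc : ∀ (x : EuclideanSpace ℝ (Fin 3)) (t : ℝ), c (x + t • eZ) = c x) : IsAxiallyPeriodic P c :=
  fun x => hc x P

/-- The derivative of a periodic function is periodic. [folklore] -/
private theorem periodic_fderiv_pea {P : ℝ} {f : EuclideanSpace ℝ (Fin 3) → ℝ}
    (hf : IsAxiallyPeriodic P f) : IsAxiallyPeriodic P (fderiv ℝ f) := by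
  intro x
  have hfun : (fun y => f (y + P • EuclideanSpace.single (2 : Fin 3) (1 : ℝ))) = f := funext hf
  have h := fderiv_comp_add_right (𝕜 := ℝ) (f := f) (x := x)
    (P • EuclideanSpace.single (2 : Fin 3) (1 : ℝ))
  rw [hfun] at h
  exact h.symm

/-- The gradient of a periodic function is periodic. [folklore] -/
private theorem periodic_gradient_pea {P : ℝ} {f : EuclideanSpace ℝ (Fin 3) → ℝ}
    (hf : IsAxiallyPeriodic P f) : IsAxiallyPeriodic P (gradient f) := by
  intro x
  simp only [gradient, periodic_fderiv_pea hf x]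

/-- A function equal to `1` for `r ≤ ρ'` (`ρ' > 0`) has zero derivative for `r < ρ'`. [folklore] -/
private theorem fderiv_eq_zero_of_cylRadius_lt_pea {ψ : EuclideanSpace ℝ (Fin 3) → ℝ} {ρ' : ℝ}
    (hψ1 : ∀ x, cylRadius x ≤ ρ' → ψ x = 1) {x : EuclideanSpace ℝ (Fin 3)} (hx : cylRadius x < ρ') :
    fderiv ℝ ψ x = 0 := by
  have hopen : IsOpen {y : EuclideanSpace ℝ (Fin 3) | cylRadius y < ρ'} :=
    isOpen_lt continuous_cylRadius continuous_const
  have hev : ψ =ᶠ[𝓝 x] fun _ => 1 := by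
    filter_upwards [hopen.mem_nhds hx] with y hy
    exact hψ1 y (le_of_lt hy)
  rw [hev.fderiv_eq, fderiv_const_apply]

/-- The axis point `(0,0,z)` is `z e_z`. [folklore] -/
private theorem meridianPoint_zero_eq_pea (z : ℝ) :
    meridianPoint (0, z) = (0 : EuclideanSpace ℝ (Fin 3)) + z • eZ := by
  ext i
  fin_cases i <;> simp [meridianPoint_apply_zero, meridianPoint_apply_one, meridianPoint_apply_two, eZ]

/-- `(0,0,z+P) = (0,0,z) + P e_z`. [folklore] -/
private theorem meridianPoint_zero_add_pea (z P : ℝ) :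
    meridianPoint (0, z + P) = meridianPoint (0, z) + P • eZ := by
  rw [meridianPoint_zero_eq_pea, meridianPoint_zero_eq_pea, add_assoc, add_smul]

/-- The periodic window is supported in `|z| ≤ 2P`. [folklore] -/
private theorem abs_le_of_periodicWindow_ne_zero_pea {P : ℝ} (hP : 0 < P) (z : ℝ)
    (hz : periodicWindow P z ≠ 0) : |z| ≤ 2 * P := by
  have h := mem_Ioo_of_periodicWindow_ne_zero hP hz
  rw [abs_le]
  exact ⟨by linarith [h.1], h.2.le⟩

/-- The derivative of the squared window is supported in `|z| ≤ 2P`. [folklore] -/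
private theorem abs_le_of_deriv_periodicWindow_sq_ne_zero_pea {P : ℝ} (hP : 0 < P) {z : ℝ}
    (hz : deriv (fun z => periodicWindow P z ^ 2) z ≠ 0) : |z| ≤ 2 * P := by
  by_contra habs
  rw [not_le] at habs
  have hev : (fun z => periodicWindow P z ^ 2) =ᶠ[𝓝 z] fun _ => 0 := by
    rcases lt_or_ge 0 z with h0 | h0
    · have h2 : 2 * P < z := by rw [abs_of_pos h0] at habs; exact habs
      filter_upwards [isOpen_Ioi.mem_nhds h2] with w hw
      simp [periodicWindow_eq_zero_of_two_mul_le hP (le_of_lt hw)]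
    · have h2 : z < 0 := by
        rcases h0.eq_or_lt with h | h
        · rw [h, abs_zero] at habs; linarith
        · exact h
      filter_upwards [isOpen_Iio.mem_nhds h2] with w hw
      simp [periodicWindow_eq_zero_of_nonpos hP (le_of_lt hw)]
  exact hz (by rw [hev.deriv_eq, deriv_const])

/-! ### The window identity on the axis -/

/-- For `z ∈ [0, P]` only the translates `k = 0, 1` of the window meet `z`:
`ω(z)² + ω(z + P)² = 1`. [folklore] -/
private theorem periodicWindow_sq_add_sq_pea {P : ℝ} (hP : 0 < P) {z : ℝ} (hz : z ∈ Icc 0 P) :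
    periodicWindow P z ^ 2 + periodicWindow P (z + P) ^ 2 = 1 := by
  have h := tsum_periodicWindow_sq hP z
  have hzero : ∀ k : ℤ, k ∉ ({0, 1} : Finset ℤ) → periodicWindow P (z + (k : ℝ) * P) ^ 2 = 0 := by
    intro k hk
    simp only [Finset.mem_insert, Finset.mem_singleton, not_or] at hk
    have hω : periodicWindow P (z + (k : ℝ) * P) = 0 := by
      by_contra hne
      have hm := mem_Ioo_of_periodicWindow_ne_zero hP hne
      rcases lt_or_gt_of_ne hk.1 with h0 | h0
      · have hk' : (k : ℝ) ≤ -1 := by exact_mod_cast (show k ≤ -1 by omega)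
        nlinarith [hm.1, hz.2]
      · have hk' : (2 : ℝ) ≤ k := by exact_mod_cast (show 2 ≤ k by omega)
        nlinarith [hm.2, hz.1]
    rw [hω]; ring
  rw [tsum_eq_sum (s := ({0, 1} : Finset ℤ)) (fun k hk => hzero k hk)] at h
  simpa using h

/-- **The window identity on the axis**: for a continuous `P`-periodic `f : ℝ → ℝ` (`P > 0`),
`∫_ℝ f(z) ω(z)² dz = ∫_0^P f` (`ω = periodicWindow P`; the `z`-part of "integrating over one
period"). [cite: LeiRenZhang2019, §2 (the z-periodic setting and the domains D_R = {r<R}×[0,Z₀), arXiv p. 5)] -/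
theorem integral_mul_periodicWindow_sq_real {P : ℝ} (hP : 0 < P) {f : ℝ → ℝ} (hf : Continuous f)
    (hfp : Function.Periodic f P) :
    ∫ z, f z * periodicWindow P z ^ 2 = ∫ z in (0 : ℝ)..P, f z := by
  have hωc : Continuous fun z => periodicWindow P z ^ 2 := (contDiff_periodicWindow_sq P (n := 0)).continuous
  have hgc : Continuous fun z => f z * periodicWindow P z ^ 2 := hf.mul hωc
  -- the integrand vanishes off `[0, 2P]`
  have hzero : ∀ z, z ∉ Ioc (0 : ℝ) (2 * P) → f z * periodicWindow P z ^ 2 = 0 := by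
    intro z hz
    have hω : periodicWindow P z = 0 := by
      by_contra hne
      have hm := mem_Ioo_of_periodicWindow_ne_zero hP hne
      exact hz ⟨hm.1, hm.2.le⟩
    rw [hω]; ring
  have h1 : ∫ z, f z * periodicWindow P z ^ 2 = ∫ z in (0 : ℝ)..(2 * P), f z * periodicWindow P z ^ 2 := by
    rw [intervalIntegral.integral_of_le (by positivity),
      setIntegral_eq_integral_of_forall_compl_eq_zero fun z hz => hzero z hz]
  have hi : ∀ a b : ℝ, IntervalIntegrable (fun z => f z * periodicWindow P z ^ 2) volume a b :=
    fun a b => hgc.intervalIntegrable _ _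
  rw [h1, ← intervalIntegral.integral_add_adjacent_intervals (hi 0 P) (hi P (2 * P))]
  have h2 : ∫ z in P..(2 * P), f z * periodicWindow P z ^ 2 =
      ∫ z in (0 : ℝ)..P, f z * periodicWindow P (z + P) ^ 2 := by
    have h := intervalIntegral.integral_comp_add_right (fun z => f z * periodicWindow P z ^ 2) P
      (a := 0) (b := P)
    simp only [zero_add, two_mul] at h ⊢
    rw [← h]
    refine intervalIntegral.integral_congr fun z _ => ?_
    simp only [hfp z]
  have hi' : IntervalIntegrable (fun z => f z * periodicWindow P (z + P) ^ 2) volume 0 P :=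
    (show Continuous fun z => f z * periodicWindow P (z + P) ^ 2 from
      hf.mul (hωc.comp (continuous_id.add continuous_const))).intervalIntegrable _ _
  rw [h2, ← intervalIntegral.integral_add (hi 0 P) hi']
  refine intervalIntegral.integral_congr fun z hz => ?_
  rw [uIcc_of_le hP.le] at hz
  have h := periodicWindow_sq_add_sq_pea hP hz
  show f z * periodicWindow P z ^ 2 + f z * periodicWindow P (z + P) ^ 2 = f z
  calc f z * periodicWindow P z ^ 2 + f z * periodicWindow P (z + P) ^ 2
      = f z * (periodicWindow P z ^ 2 + periodicWindow P (z + P) ^ 2) := by ring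
    _ = f z := by rw [h, mul_one]

/-! ### The identity for a divergence-free drift -/

/-- **Energy identity with the axis boundary term, divergence-free drift** (the
`LeiZhang2011.energy_identity_axis` of the tree with "`∇·b = 0`" in place of `b = curl B`, as
in Lei–Ren–Zhang §3). For `F(s,·) ∈ C²` axisymmetric, a `C¹` divergence-free drift `b(s,·)`,
the time-integrated equation `F(s) = F(t₁) + ∫_{t₁}^s N`, `N = ΔF − DF[b] − (2/r)∂ᵣF`, for a.e.
`x`, `H ∈ C²`, an axisymmetric cut-off `φ ∈ C²_c`, `η ∈ C¹`, and the space–time integrand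
`(H'(F)Nη + H(F)η')φ²` integrable on `(t₁,t₂] × ℝ³`:
`∫ (H(F(t₂))η(t₂) − H(F(t₁))η(t₁)) φ² = ∫_{t₁}^{t₂} (η(s)[−∫(H''(F)‖∇F‖²φ² + H'(F)⟪∇F,∇φ²⟫)`
`+ ∫H(F)⟪b,∇φ²⟫ + ∫(2/r)H(F)∂ᵣ(φ²) + 2c₂∫H(F(s,(0,0,z)))φ(0,0,z)² dz] + η'(s)∫H(F)φ²) ds`. [cite: LeiRenZhang2019, §3 (3.3)–(3.4) and (3.13)–(3.15) (testing the equation with ζ_R², using ∇·b = 0; the axis terms (3.7), (3.14)), arXiv pp. 7–9] -/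
theorem energy_identity_axis_divFree {F N : ℝ → EuclideanSpace ℝ (Fin 3) → ℝ}
    {b : ℝ → EuclideanSpace ℝ (Fin 3) → EuclideanSpace ℝ (Fin 3)} {t₁ t₂ : ℝ} (ht : t₁ ≤ t₂)
    (hF2 : ∀ s, ContDiff ℝ 2 (F s)) (hFa : ∀ s, IsAxisymmetricScalar (F s))
    (hb1 : ∀ s, ContDiff ℝ 1 (b s)) (hbdiv : ∀ s x, VectorCalculus.divergence (b s) x = 0)
    (hN : ∀ s x, N s x =
      (Δ (F s)) x - fderiv ℝ (F s) x (b s x) - 2 / cylRadius x * fderiv ℝ (F s) x (eR x))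
    (heq : ∀ᵐ x ∂(volume : Measure (EuclideanSpace ℝ (Fin 3))),
      IntervalIntegrable (fun s => N s x) volume t₁ t₂ ∧
        ∀ s ∈ Icc t₁ t₂, F s x = F t₁ x + ∫ τ in t₁..s, N τ x)
    {H : ℝ → ℝ} (hH : ContDiff ℝ 2 H)
    {φ : EuclideanSpace ℝ (Fin 3) → ℝ} (hφ : ContDiff ℝ 2 φ) (hφc : HasCompactSupport φ)
    (hφa : IsAxisymmetricScalar φ) {η : ℝ → ℝ} (hη : ContDiff ℝ 1 η)
    (hint : Integrable (fun p : ℝ × EuclideanSpace ℝ (Fin 3) =>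
      (deriv H (F p.1 p.2) * N p.1 p.2 * η p.1 + H (F p.1 p.2) * deriv η p.1) * φ p.2 ^ 2)
      ((volume.restrict (Ioc t₁ t₂)).prod volume)) :
    ∫ x, (H (F t₂ x) * η t₂ - H (F t₁ x) * η t₁) * φ x ^ 2 =
      ∫ s in t₁..t₂, (η s *
        (-(∫ x, (deriv (deriv H) (F s x) * ‖gradient (F s) x‖ ^ 2 * φ x ^ 2 +
            deriv H (F s x) * ⟪gradient (F s) x, gradient (fun y => φ y ^ 2) x⟫)) +
          (∫ x, H (F s x) * ⟪b s x, gradient (fun y => φ y ^ 2) x⟫) +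
          ((∫ x, 2 / cylRadius x * (H (F s x) * fderiv ℝ (fun y => φ y ^ 2) x (eR x))) +
            2 * radialConst₂ * ∫ z : ℝ, H (F s (meridianPoint (0, z))) * φ (meridianPoint (0, z)) ^ 2)) +
        deriv η s * ∫ x, H (F s x) * φ x ^ 2) := by
  -- Step 1: the integrated chain rule in time, under `∫ … φ² dx`
  have h1 := integral_comp_mul_sub_eq_integral_integral_ae (μ := volume) ht heq
    (hH.of_le one_le_two) hη (fun x => φ x ^ 2) hint
  rw [h1]
  -- Step 2: the slice identities, for every `s`
  have hH1 : ContDiff ℝ 1 H := hH.of_le one_le_two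
  have hφ1 : ContDiff ℝ 1 φ := hφ.of_le one_le_two
  have hφ2c : HasCompactSupport fun y => φ y ^ 2 :=
    hφc.comp_left (g := fun t : ℝ => t ^ 2) (by simp)
  refine intervalIntegral.integral_congr fun s _ => ?_
  -- the four pieces and their integrability
  set P₁ : EuclideanSpace ℝ (Fin 3) → ℝ := fun x => deriv H (F s x) * φ x ^ 2 * (Δ (F s)) x
    with hP₁
  set P₂ : EuclideanSpace ℝ (Fin 3) → ℝ := fun x =>
    ⟪b s x, gradient (F s) x⟫ * (deriv H (F s x) * φ x ^ 2) with hP₂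
  set P₃ : EuclideanSpace ℝ (Fin 3) → ℝ := fun x =>
    2 / cylRadius x * (fderiv ℝ (F s) x (eR x) * (deriv H (F s x) * φ x ^ 2)) with hP₃
  set P₄ : EuclideanSpace ℝ (Fin 3) → ℝ := fun x => H (F s x) * φ x ^ 2 with hP₄
  have hHF : Continuous fun x => deriv H (F s x) :=
    (hH.continuous_deriv (by norm_num)).comp (hF2 s).continuous
  have hσc : Continuous fun x => deriv H (F s x) * φ x ^ 2 := hHF.mul (hφ.continuous.pow 2)
  have hσcs : HasCompactSupport fun x => deriv H (F s x) * φ x ^ 2 := hφ2c.mul_left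
  have hΔc : Continuous (Δ (F s)) := by
    have h2 : ContDiff ℝ ((0 : ℕ∞) + 2 : ℕ∞) (F s) := by simpa using hF2 s
    exact (contDiff_laplacian (n := 0) h2).continuous
  have hiP₁ : Integrable P₁ (volume : Measure (EuclideanSpace ℝ (Fin 3))) :=
    (hσc.mul hΔc).integrable_of_hasCompactSupport hσcs.mul_right
  have hgradF : Continuous (gradient (F s)) := continuous_gradient_of_contDiff ((hF2 s).of_le one_le_two)
  have hiP₂ : Integrable P₂ (volume : Measure (EuclideanSpace ℝ (Fin 3))) :=
    (((hb1 s).continuous.inner hgradF).mul hσc).integrable_of_hasCompactSupport hσcs.mul_left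
  obtain ⟨hiP₃, -, e₃⟩ := integral_axis_term_eq_sub_boundary ((hF2 s).of_le one_le_two) (hFa s) hH1
    hφ1 hφc hφa
  have hiP₄ : Integrable P₄ (volume : Measure (EuclideanSpace ℝ (Fin 3))) :=
    ((hH.continuous.comp (hF2 s).continuous).mul (hφ.continuous.pow 2)).integrable_of_hasCompactSupport
      hφ2c.mul_left
  -- pointwise: the integrand is `η s (P₁ − P₂ − P₃) + η' s P₄`
  have hpt : ∀ x, (deriv H (F s x) * N s x * η s + H (F s x) * deriv η s) * φ x ^ 2 =
      η s * (P₁ x - P₂ x - P₃ x) + deriv η s * P₄ x := by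
    intro x
    simp only [hP₁, hP₂, hP₃, hP₄, hN s x, ← inner_gradient_left (F s) x (b s x),
      real_inner_comm (b s x)]
    ring
  simp_rw [hpt]
  rw [integral_add (((hiP₁.sub' hiP₂).sub' hiP₃).const_mul (η s)) (hiP₄.const_mul (deriv η s)),
    MeasureTheory.integral_const_mul, MeasureTheory.integral_const_mul,
    integral_sub (hiP₁.sub' hiP₂) hiP₃, integral_sub hiP₁ hiP₂]
  have e₁ : ∫ x, P₁ x = -∫ x, (deriv (deriv H) (F s x) * ‖gradient (F s) x‖ ^ 2 * φ x ^ 2 +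
      deriv H (F s x) * ⟪gradient (F s) x, gradient (fun y => φ y ^ 2) x⟫) :=
    integral_laplacian_mul_deriv_comp_mul_sq (hF2 s) hH hφ1 hφc
  have e₂ : ∫ x, P₂ x = -∫ x, H (F s x) * ⟪b s x, gradient (fun y => φ y ^ 2) x⟫ :=
    integral_inner_gradient_mul_deriv_comp_mul_sq_divFree (hb1 s) (hbdiv s) (hF2 s) hH hφ hφc
  rw [e₁, e₂]
  rw [show (∫ x, P₃ x) = (-∫ x, 2 / cylRadius x * (H (F s x) * fderiv ℝ (fun y => φ y ^ 2) x (eR x))) -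
      2 * radialConst₂ * ∫ z : ℝ, H (F s (meridianPoint (0, z))) * φ (meridianPoint (0, z)) ^ 2 from e₃]
  ring

/-! ### The identity per period -/

section Periodic

variable {P ρ ρ' : ℝ} {F : EuclideanSpace ℝ (Fin 3) → ℝ} {b : EuclideanSpace ℝ (Fin 3) → EuclideanSpace ℝ (Fin 3)}
  {H : ℝ → ℝ} {ψ : EuclideanSpace ℝ (Fin 3) → ℝ}

/-- **Window reduction of the viscous term**:
`∫ (H''(F)‖∇F‖²φ̃² + H'(F)⟪∇F,∇φ̃²⟫) = ∫_{zSlab P 0} (H''(F)‖∇F‖²ψ² + H'(F)⟪∇F,∇ψ²⟫)`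
for `φ̃ = ψ ω(x₂)` (the `(ω²)′`-term integrates to zero by periodicity). [cite: LeiRenZhang2019, §3 (3.3) (the terms ∫|∇Ψ|²ζ_R² and ∇Ψ·∇ζ_R² over one period D_R), arXiv p. 7] -/
theorem viscous_window_eq (hP : 0 < P) (hF : ContDiff ℝ 2 F) (hFp : IsAxiallyPeriodic P F)
    (hH : ContDiff ℝ 2 H) (hψ : ContDiff ℝ 2 ψ)
    (hψz : ∀ (x : EuclideanSpace ℝ (Fin 3)) (t : ℝ), ψ (x + t • eZ) = ψ x)
    (hψ0 : ∀ x, ρ ≤ cylRadius x → ψ x = 0) :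
    ∫ x, (deriv (deriv H) (F x) * ‖gradient F x‖ ^ 2 * (ψ x * periodicWindow P (x 2)) ^ 2 +
        deriv H (F x) * ⟪gradient F x, gradient (fun y => (ψ y * periodicWindow P (y 2)) ^ 2) x⟫) =
      ∫ x in zSlab P 0, (deriv (deriv H) (F x) * ‖gradient F x‖ ^ 2 * ψ x ^ 2 +
        deriv H (F x) * ⟪gradient F x, gradient (fun y => ψ y ^ 2) x⟫) := by
  have hψp : IsAxiallyPeriodic P ψ := periodic_of_forall_add_smul_pea hψz
  have hψ1 : ContDiff ℝ 1 ψ := hψ.of_le one_le_two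
  have hH'c : Continuous (deriv H) := hH.continuous_deriv (by norm_num)
  have hH''c : Continuous (deriv (deriv H)) := by
    have h2 : ContDiff ℝ (1 + 1) H := by rw [one_add_one_eq_two]; exact hH
    exact h2.deriv'.continuous_deriv le_rfl
  have hgradF : Continuous (gradient F) := continuous_gradient_of_contDiff (hF.of_le one_le_two)
  have hgradψ2 : Continuous (gradient fun y => ψ y ^ 2) := continuous_gradient_of_contDiff (hψ1.pow 2)
  -- the two slab data
  set Q₁ : EuclideanSpace ℝ (Fin 3) → ℝ := fun x => deriv (deriv H) (F x) * ‖gradient F x‖ ^ 2 * ψ x ^ 2 +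
    deriv H (F x) * ⟪gradient F x, gradient (fun y => ψ y ^ 2) x⟫ with hQ₁
  set Q₂ : EuclideanSpace ℝ (Fin 3) → ℝ := fun x => deriv H (F x) * fderiv ℝ F x eZ * ψ x ^ 2 with hQ₂
  have hQ₁c : Continuous Q₁ :=
    (((hH''c.comp hF.continuous).mul (hgradF.norm.pow 2)).mul (hψ.continuous.pow 2)).add
      ((hH'c.comp hF.continuous).mul (hgradF.inner hgradψ2))
  have hQ₂c : Continuous Q₂ :=
    ((hH'c.comp hF.continuous).mul ((hF.continuous_fderiv (by norm_num)).clm_apply continuous_const)).mul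
      (hψ.continuous.pow 2)
  have hgradψ2_0 : ∀ x, ρ < cylRadius x → gradient (fun y => ψ y ^ 2) x = 0 := by
    intro x hx
    have hopen : IsOpen {y : EuclideanSpace ℝ (Fin 3) | ρ < cylRadius y} :=
      isOpen_lt continuous_const continuous_cylRadius
    have hev : (fun y => ψ y ^ 2) =ᶠ[𝓝 x] fun _ => 0 := by
      filter_upwards [hopen.mem_nhds hx] with y hy
      simp [hψ0 y hy.le]
    rw [gradient, hev.fderiv_eq, fderiv_const_apply, map_zero]
  have hQ₁0 : ∀ x, ρ + 1 ≤ cylRadius x → Q₁ x = 0 := fun x hx => by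
    simp only [hQ₁, hψ0 x (by linarith), hgradψ2_0 x (by linarith), inner_zero_right]; ring
  have hQ₂0 : ∀ x, ρ ≤ cylRadius x → Q₂ x = 0 := fun x hx => by simp only [hQ₂, hψ0 x hx]; ring
  have hQ₁p : IsAxiallyPeriodic P Q₁ := periodic_of_eZ_pea fun x => by
    simp only [hQ₁, periodic_apply_pea hFp, periodic_apply_pea (periodic_gradient_pea hFp),
      periodic_apply_pea hψp, periodic_apply_pea (periodic_gradient_pea (P := P) (f := fun y => ψ y ^ 2)
        (periodic_of_eZ_pea fun y => by simp only [periodic_apply_pea hψp]))]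
  have hQ₂p : IsAxiallyPeriodic P Q₂ := periodic_of_eZ_pea fun x => by
    simp only [hQ₂, periodic_apply_pea hFp, periodic_apply_pea (periodic_fderiv_pea hFp),
      periodic_apply_pea hψp]
  obtain ⟨h₁, -⟩ := integral_mul_window_sq_eq_and_deriv_eq_zero hP hQ₁c hQ₁p hQ₁0
  obtain ⟨-, h₂⟩ := integral_mul_window_sq_eq_and_deriv_eq_zero hP hQ₂c hQ₂p hQ₂0
  -- pointwise splitting of the integrand
  have hpt : ∀ x, deriv (deriv H) (F x) * ‖gradient F x‖ ^ 2 * (ψ x * periodicWindow P (x 2)) ^ 2 +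
      deriv H (F x) * ⟪gradient F x, gradient (fun y => (ψ y * periodicWindow P (y 2)) ^ 2) x⟫ =
      Q₁ x * periodicWindow P (x 2) ^ 2 + Q₂ x * deriv (fun z => periodicWindow P z ^ 2) (x 2) := by
    intro x
    rw [gradient_windowCutoff_sq P hψ1 x, inner_add_right, real_inner_smul_right, real_inner_smul_right,
      inner_gradient_left F x eZ]
    simp only [hQ₁, hQ₂]
    ring
  simp_rw [hpt]
  have hi₁ : Integrable (fun x => Q₁ x * periodicWindow P (x 2) ^ 2) (volume : Measure (EuclideanSpace ℝ (Fin 3))) :=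
    integrable_mul_periodicWindow_sq hP hQ₁p hQ₁c.aestronglyMeasurable
      (integrableOn_zSlab_of_eq_zero_of_le_cylRadius hQ₁c hQ₁0 P 0)
  have hi₂ : Integrable (fun x => Q₂ x * deriv (fun z => periodicWindow P z ^ 2) (x 2))
      (volume : Measure (EuclideanSpace ℝ (Fin 3))) := by
    have hc : Continuous fun x : EuclideanSpace ℝ (Fin 3) => Q₂ x * deriv (fun z => periodicWindow P z ^ 2) (x 2) :=
      hQ₂c.mul (((contDiff_periodicWindow_sq P (n := 1)).continuous_deriv le_rfl).comp
        (EuclideanSpace.proj (𝕜 := ℝ) (2 : Fin 3)).continuous)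
    refine hc.integrable_of_hasCompactSupport (hasCompactSupport_mul_comp_apply_two hQ₂0 (A := 2 * P) ?_)
    exact fun z hz => abs_le_of_deriv_periodicWindow_sq_ne_zero_pea hP hz
  rw [integral_add hi₁ hi₂, h₁, h₂, add_zero]

/-- **Window reduction of the drift term**:
`∫ H(F)⟪b, ∇φ̃²⟫ = ∫_{zSlab P 0} H(F)⟪b, ∇ψ²⟫` for `φ̃ = ψ ω(x₂)` and a continuous periodic
drift (the `(ω²)′`-term `∫ H(F)ψ² b_z (ω²)′` vanishes by periodicity). [cite: LeiRenZhang2019, §3 (3.4) (the drift term ∫(v_r∂ᵣζ_R² + v_z∂_zζ_R²)Ψ over one period), arXiv p. 7] -/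
theorem drift_window_eq (hP : 0 < P) (hF : ContDiff ℝ 2 F) (hFp : IsAxiallyPeriodic P F)
    (hb : Continuous b) (hbp : IsAxiallyPeriodic P b) (hH : ContDiff ℝ 2 H) (hψ : ContDiff ℝ 2 ψ)
    (hψz : ∀ (x : EuclideanSpace ℝ (Fin 3)) (t : ℝ), ψ (x + t • eZ) = ψ x)
    (hψ0 : ∀ x, ρ ≤ cylRadius x → ψ x = 0) :
    ∫ x, H (F x) * ⟪b x, gradient (fun y => (ψ y * periodicWindow P (y 2)) ^ 2) x⟫ =
      ∫ x in zSlab P 0, H (F x) * ⟪b x, gradient (fun y => ψ y ^ 2) x⟫ := by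
  have hψp : IsAxiallyPeriodic P ψ := periodic_of_forall_add_smul_pea hψz
  have hψ1 : ContDiff ℝ 1 ψ := hψ.of_le one_le_two
  have hHFc : Continuous fun x => H (F x) := hH.continuous.comp hF.continuous
  have hgradψ2 : Continuous (gradient fun y => ψ y ^ 2) := continuous_gradient_of_contDiff (hψ1.pow 2)
  set Q₁ : EuclideanSpace ℝ (Fin 3) → ℝ := fun x => H (F x) * ⟪b x, gradient (fun y => ψ y ^ 2) x⟫ with hQ₁
  set Q₂ : EuclideanSpace ℝ (Fin 3) → ℝ := fun x => H (F x) * ψ x ^ 2 * ⟪b x, eZ⟫ with hQ₂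
  have hQ₁c : Continuous Q₁ := hHFc.mul (hb.inner hgradψ2)
  have hQ₂c : Continuous Q₂ := (hHFc.mul (hψ.continuous.pow 2)).mul (hb.inner continuous_const)
  have hgradψ2_0 : ∀ x, ρ < cylRadius x → gradient (fun y => ψ y ^ 2) x = 0 := by
    intro x hx
    have hopen : IsOpen {y : EuclideanSpace ℝ (Fin 3) | ρ < cylRadius y} :=
      isOpen_lt continuous_const continuous_cylRadius
    have hev : (fun y => ψ y ^ 2) =ᶠ[𝓝 x] fun _ => 0 := by
      filter_upwards [hopen.mem_nhds hx] with y hy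
      simp [hψ0 y hy.le]
    rw [gradient, hev.fderiv_eq, fderiv_const_apply, map_zero]
  have hQ₁0 : ∀ x, ρ + 1 ≤ cylRadius x → Q₁ x = 0 := fun x hx => by
    simp only [hQ₁, hgradψ2_0 x (by linarith), inner_zero_right, mul_zero]
  have hQ₂0 : ∀ x, ρ ≤ cylRadius x → Q₂ x = 0 := fun x hx => by simp only [hQ₂, hψ0 x hx]; ring
  have hQ₁p : IsAxiallyPeriodic P Q₁ := periodic_of_eZ_pea fun x => by
    simp only [hQ₁, periodic_apply_pea hFp, periodic_apply_pea hbp,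
      periodic_apply_pea (periodic_gradient_pea (P := P) (f := fun y => ψ y ^ 2)
        (periodic_of_eZ_pea fun y => by simp only [periodic_apply_pea hψp]))]
  have hQ₂p : IsAxiallyPeriodic P Q₂ := periodic_of_eZ_pea fun x => by
    simp only [hQ₂, periodic_apply_pea hFp, periodic_apply_pea hbp, periodic_apply_pea hψp]
  obtain ⟨h₁, -⟩ := integral_mul_window_sq_eq_and_deriv_eq_zero hP hQ₁c hQ₁p hQ₁0
  obtain ⟨-, h₂⟩ := integral_mul_window_sq_eq_and_deriv_eq_zero hP hQ₂c hQ₂p hQ₂0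
  have hpt : ∀ x, H (F x) * ⟪b x, gradient (fun y => (ψ y * periodicWindow P (y 2)) ^ 2) x⟫ =
      Q₁ x * periodicWindow P (x 2) ^ 2 + Q₂ x * deriv (fun z => periodicWindow P z ^ 2) (x 2) := by
    intro x
    rw [gradient_windowCutoff_sq P hψ1 x, inner_add_right, real_inner_smul_right, real_inner_smul_right]
    simp only [hQ₁, hQ₂]
    ring
  simp_rw [hpt]
  have hi₁ : Integrable (fun x => Q₁ x * periodicWindow P (x 2) ^ 2) (volume : Measure (EuclideanSpace ℝ (Fin 3))) :=
    integrable_mul_periodicWindow_sq hP hQ₁p hQ₁c.aestronglyMeasurable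
      (integrableOn_zSlab_of_eq_zero_of_le_cylRadius hQ₁c hQ₁0 P 0)
  have hi₂ : Integrable (fun x => Q₂ x * deriv (fun z => periodicWindow P z ^ 2) (x 2))
      (volume : Measure (EuclideanSpace ℝ (Fin 3))) := by
    have hc : Continuous fun x : EuclideanSpace ℝ (Fin 3) => Q₂ x * deriv (fun z => periodicWindow P z ^ 2) (x 2) :=
      hQ₂c.mul (((contDiff_periodicWindow_sq P (n := 1)).continuous_deriv le_rfl).comp
        (EuclideanSpace.proj (𝕜 := ℝ) (2 : Fin 3)).continuous)
    refine hc.integrable_of_hasCompactSupport (hasCompactSupport_mul_comp_apply_two hQ₂0 (A := 2 * P) ?_)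
    exact fun z hz => abs_le_of_deriv_periodicWindow_sq_ne_zero_pea hP hz
  rw [integral_add hi₁ hi₂, h₁, h₂, add_zero]

/-- **Window reduction of the axis term**:
`∫ (2/r)H(F)∂ᵣ(φ̃²) = ∫_{zSlab P 0} (2/r)H(F)∂ᵣ(ψ²)` for `φ̃ = ψω(x₂)` (`(e_r)₂ = 0`), for a
`z`-independent cut-off `ψ` with `∇ψ = a x_h`, `a` continuous and `z`-independent, `ψ = 1` on
`{r ≤ ρ'}` (`ρ' > 0`), `ψ = 0` on `{r ≥ ρ}`. [cite: LeiRenZhang2019, §3 (3.7) (the axis term −∫(2/r)∂ᵣΨζ_R² over one period and its integration by parts), arXiv p. 7] -/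
theorem axis_window_eq (hP : 0 < P) (hF : ContDiff ℝ 2 F) (hFp : IsAxiallyPeriodic P F)
    (hH : ContDiff ℝ 2 H) (hψ : ContDiff ℝ 2 ψ)
    (hψz : ∀ (x : EuclideanSpace ℝ (Fin 3)) (t : ℝ), ψ (x + t • eZ) = ψ x)
    (hρ' : 0 < ρ') (hψ1 : ∀ x, cylRadius x ≤ ρ' → ψ x = 1) (hψ0 : ∀ x, ρ ≤ cylRadius x → ψ x = 0)
    {a : EuclideanSpace ℝ (Fin 3) → ℝ} (ha : Continuous a)
    (haz : ∀ (x : EuclideanSpace ℝ (Fin 3)) (t : ℝ), a (x + t • eZ) = a x)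
    (hψg : ∀ x, gradient ψ x = a x • horizPart x) :
    ∫ x, 2 / cylRadius x * (H (F x) *
        fderiv ℝ (fun y => (ψ y * periodicWindow P (y 2)) ^ 2) x (eR x)) =
      ∫ x in zSlab P 0, 2 / cylRadius x * (H (F x) * fderiv ℝ (fun y => ψ y ^ 2) x (eR x)) := by
  have hψp : IsAxiallyPeriodic P ψ := periodic_of_forall_add_smul_pea hψz
  have hap : IsAxiallyPeriodic P a := periodic_of_forall_add_smul_pea haz
  have hψ1' : ContDiff ℝ 1 ψ := hψ.of_le one_le_two
  have hψd : Differentiable ℝ ψ := hψ1'.differentiable one_ne_zero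
  have hHFc : Continuous fun x => H (F x) := hH.continuous.comp hF.continuous
  -- `∂ᵣψ = a r` and `∂ᵣ(ψ²) = 2ψ a r`
  have hdr : ∀ x, fderiv ℝ ψ x (eR x) = a x * cylRadius x := fun x => by
    rw [← inner_gradient_left, hψg x, real_inner_smul_left, inner_horizPart_eR]
  have hsq : ∀ x (v : EuclideanSpace ℝ (Fin 3)), fderiv ℝ (fun y => ψ y ^ 2) x v = 2 * ψ x * fderiv ℝ ψ x v := by
    intro x v
    have h := gradient_comp_apply (H := fun t : ℝ => t ^ 2) (F := ψ) ((differentiable_pow 2) (ψ x)) (hψd x)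
    simp only [deriv_pow_field, Nat.cast_ofNat, Nat.add_one_sub_one, pow_one] at h
    rw [← inner_gradient_left, h, real_inner_smul_left, inner_gradient_left]
  -- `a r = 0` where `∇ψ = 0`
  have har0 : ∀ x, fderiv ℝ ψ x = 0 → a x * cylRadius x = 0 := by
    intro x hx
    have h : a x • horizPart x = 0 := by rw [← hψg x, gradient, hx, map_zero]
    rcases smul_eq_zero.1 h with h | h
    · rw [h, zero_mul]
    · rw [← norm_horizPart, h, norm_zero, mul_zero]
  have har_in : ∀ x, cylRadius x < ρ' → a x * cylRadius x = 0 := fun x hx =>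
    har0 x (fderiv_eq_zero_of_cylRadius_lt_pea hψ1 hx)
  have har_out : ∀ x, ρ < cylRadius x → a x * cylRadius x = 0 := by
    intro x hx
    refine har0 x ?_
    have hopen : IsOpen {y : EuclideanSpace ℝ (Fin 3) | ρ < cylRadius y} :=
      isOpen_lt continuous_const continuous_cylRadius
    have hev : ψ =ᶠ[𝓝 x] fun _ => 0 := by
      filter_upwards [hopen.mem_nhds hx] with y hy
      exact hψ0 y hy.le
    rw [hev.fderiv_eq]
    exact fderiv_const_apply _
  -- the continuous representative of the slab datum
  set Q : EuclideanSpace ℝ (Fin 3) → ℝ := fun x =>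
    2 / cylRadius x * (H (F x) * fderiv ℝ (fun y => ψ y ^ 2) x (eR x)) with hQ
  set Q' : EuclideanSpace ℝ (Fin 3) → ℝ := fun x =>
    2 / max (cylRadius x) (ρ' / 2) * (H (F x) * (2 * ψ x * (a x * cylRadius x))) with hQ'
  have hQQ' : Q = Q' := by
    funext x
    simp only [hQ, hQ', hsq x, hdr x]
    by_cases hx : cylRadius x < ρ'
    · rw [har_in x hx]; ring
    · rw [max_eq_left (by linarith [not_lt.1 hx])]
  have hQ'c : Continuous Q' := by
    have hmax : Continuous fun x : EuclideanSpace ℝ (Fin 3) => max (cylRadius x) (ρ' / 2) :=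
      continuous_cylRadius.max continuous_const
    have hk : Continuous fun x : EuclideanSpace ℝ (Fin 3) => 2 / max (cylRadius x) (ρ' / 2) :=
      continuous_const.div hmax fun x => (lt_max_of_lt_right (by positivity)).ne'
    exact hk.mul (hHFc.mul ((continuous_const.mul hψ.continuous).mul (ha.mul continuous_cylRadius)))
  have hcylz : ∀ (x : EuclideanSpace ℝ (Fin 3)) (t : ℝ), cylRadius (x + t • eZ) = cylRadius x := fun x t => by
    rw [← norm_horizPart, horizPart_add_smul_eZ, norm_horizPart]
  have hQ'p : IsAxiallyPeriodic P Q' := periodic_of_eZ_pea fun x => by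
    simp only [hQ', periodic_apply_pea hFp, periodic_apply_pea hψp, periodic_apply_pea hap, hcylz]
  have hQ'0 : ∀ x, ρ + 1 ≤ cylRadius x → Q' x = 0 := fun x hx => by
    simp only [hQ', har_out x (by linarith)]; ring
  obtain ⟨h₁, -⟩ := integral_mul_window_sq_eq_and_deriv_eq_zero hP hQ'c hQ'p hQ'0
  -- pointwise: `∂ᵣ(φ̃²) = ω² ∂ᵣ(ψ²)`
  have hpt : ∀ x, 2 / cylRadius x * (H (F x) *
      fderiv ℝ (fun y => (ψ y * periodicWindow P (y 2)) ^ 2) x (eR x)) = Q' x * periodicWindow P (x 2) ^ 2 := by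
    intro x
    rw [← hQQ']
    have hfun : (fun y : EuclideanSpace ℝ (Fin 3) => (ψ y * periodicWindow P (y 2)) ^ 2) =
        fun y => (fun y => ψ y ^ 2) y * (fun z => periodicWindow P z ^ 2) (y 2) := by
      funext y; ring
    rw [hfun, fderiv_mul_comp_apply_two_eR (((hψ1'.pow 2).differentiable one_ne_zero) x)
      (((contDiff_periodicWindow_sq P (n := 1)).differentiable one_ne_zero) _)]
    simp only [hQ]
    ring
  simp_rw [hpt]
  rw [h₁, ← hQQ']

/-- **Window reduction of the axis boundary term**:
`∫_ℝ H(F(0,0,z)) φ̃(0,0,z)² dz = ψ(0)² ∫_0^P H(F(0,0,z)) dz` for `φ̃ = ψ ω(x₂)` with `ψ`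
`z`-independent and `F` axially `P`-periodic. [cite: LeiRenZhang2019, §3 (3.7) and (3.14) (the boundary terms 2∬(Ψ−Ψ̄)ζ_R²dθdz|_{r=0}, −2∭√Φ|_{r=0}ψ²dθdzdt over one period), arXiv pp. 7–8] -/
theorem axisBoundary_window_eq (hP : 0 < P) (hF : Continuous F) (hFp : IsAxiallyPeriodic P F)
    (hHc : Continuous H) (hψz : ∀ (x : EuclideanSpace ℝ (Fin 3)) (t : ℝ), ψ (x + t • eZ) = ψ x) :
    ∫ z : ℝ, H (F (meridianPoint (0, z))) * (ψ (meridianPoint (0, z)) * periodicWindow P ((meridianPoint (0, z)) 2)) ^ 2 =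
      ψ 0 ^ 2 * ∫ z in (0 : ℝ)..P, H (F (meridianPoint (0, z))) := by
  have hψax : ∀ z : ℝ, ψ (meridianPoint (0, z)) = ψ 0 := fun z => by
    rw [meridianPoint_zero_eq_pea, hψz]
  have hf : Continuous fun z : ℝ => H (F (meridianPoint (0, z))) := by
    have hmp : Continuous fun z : ℝ => meridianPoint (0, z) := by
      have h : (fun z : ℝ => meridianPoint (0, z)) = fun z => (0 : EuclideanSpace ℝ (Fin 3)) + z • eZ :=
        funext meridianPoint_zero_eq_pea
      rw [h]; exact continuous_const.add (continuous_id.smul continuous_const)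
    exact hHc.comp (hF.comp hmp)
  have hfp : Function.Periodic (fun z : ℝ => H (F (meridianPoint (0, z)))) P := fun z => by
    simp only [meridianPoint_zero_add_pea, periodic_apply_pea hFp]
  rw [← integral_mul_periodicWindow_sq_real hP hf hfp, ← MeasureTheory.integral_const_mul]
  refine integral_congr_ae (Eventually.of_forall fun z => ?_)
  simp only [hψax z, meridianPoint_apply_two]
  ring

/-- **The localized energy identity per period with the axis term (Lei–Ren–Zhang 2019, §3,
(3.3)/(3.13) integrated over one period `D_R`).** For `F(s,·) ∈ C²` axisymmetric and axially
`P`-periodic, a `C¹` divergence-free `P`-periodic drift `b(s,·)`, the time-integrated equation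
`F(s) = F(t₁) + ∫N`, `N = ΔF − DF[b] − (2/r)∂ᵣF`, `H ∈ C²`, `η ∈ C¹`, an axisymmetric
`z`-independent cut-off `ψ ∈ C²` with `ψ = 1` on `{r ≤ ρ'}`, `ψ = 0` on `{r ≥ ρ}`, `∇ψ = a x_h`,
and the space–time integrand `(H'(F)Nη + H(F)η')φ̃²` integrable for `φ̃ = ψ ω(x₂)`:
`∫_{zSlab P 0} (H(F(t₂))η(t₂) − H(F(t₁))η(t₁)) ψ² = ∫_{t₁}^{t₂} ( η(s) [ −∫_{slab}(H''(F)‖∇F‖²ψ² + H'(F)⟪∇F,∇ψ²⟫)`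
`+ ∫_{slab} H(F)⟪b,∇ψ²⟫ + ( ∫_{slab}(2/r)H(F)∂ᵣψ² + 2c₂ ψ(0)² ∫_0^P H(F(s,(0,0,z))) dz ) ] + η'(s) ∫_{slab} H(F)ψ² ) ds`. [cite: LeiRenZhang2019, §3 (3.3)–(3.8) and (3.13)–(3.15) (testing the equation with ζ_R² / ψ_R² and integrating over one period D_R; the axis boundary terms), arXiv pp. 7–9] -/
theorem energy_identity_axis_periodic {F N : ℝ → EuclideanSpace ℝ (Fin 3) → ℝ}
    {b : ℝ → EuclideanSpace ℝ (Fin 3) → EuclideanSpace ℝ (Fin 3)} {t₁ t₂ : ℝ} (ht : t₁ ≤ t₂)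
    (hP : 0 < P) (hF2 : ∀ s, ContDiff ℝ 2 (F s)) (hFa : ∀ s, IsAxisymmetricScalar (F s))
    (hFp : ∀ s, IsAxiallyPeriodic P (F s))
    (hb1 : ∀ s, ContDiff ℝ 1 (b s)) (hbdiv : ∀ s x, VectorCalculus.divergence (b s) x = 0)
    (hbp : ∀ s, IsAxiallyPeriodic P (b s))
    (hN : ∀ s x, N s x =
      (Δ (F s)) x - fderiv ℝ (F s) x (b s x) - 2 / cylRadius x * fderiv ℝ (F s) x (eR x))
    (heq : ∀ᵐ x ∂(volume : Measure (EuclideanSpace ℝ (Fin 3))),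
      IntervalIntegrable (fun s => N s x) volume t₁ t₂ ∧
        ∀ s ∈ Icc t₁ t₂, F s x = F t₁ x + ∫ τ in t₁..s, N τ x)
    (hH : ContDiff ℝ 2 H) (hψ : ContDiff ℝ 2 ψ) (hψa : IsAxisymmetricScalar ψ)
    (hψz : ∀ (x : EuclideanSpace ℝ (Fin 3)) (t : ℝ), ψ (x + t • eZ) = ψ x)
    (hρ' : 0 < ρ') (hψ1 : ∀ x, cylRadius x ≤ ρ' → ψ x = 1) (hψ0 : ∀ x, ρ ≤ cylRadius x → ψ x = 0)
    {a : EuclideanSpace ℝ (Fin 3) → ℝ} (ha : Continuous a)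
    (haz : ∀ (x : EuclideanSpace ℝ (Fin 3)) (t : ℝ), a (x + t • eZ) = a x)
    (hψg : ∀ x, gradient ψ x = a x • horizPart x) {η : ℝ → ℝ} (hη : ContDiff ℝ 1 η)
    (hint : Integrable (fun p : ℝ × EuclideanSpace ℝ (Fin 3) =>
      (deriv H (F p.1 p.2) * N p.1 p.2 * η p.1 + H (F p.1 p.2) * deriv η p.1) *
        (ψ p.2 * periodicWindow P (p.2 2)) ^ 2) ((volume.restrict (Ioc t₁ t₂)).prod volume)) :
    ∫ x in zSlab P 0, (H (F t₂ x) * η t₂ - H (F t₁ x) * η t₁) * ψ x ^ 2 =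
      ∫ s in t₁..t₂, (η s *
        (-(∫ x in zSlab P 0, (deriv (deriv H) (F s x) * ‖gradient (F s) x‖ ^ 2 * ψ x ^ 2 +
            deriv H (F s x) * ⟪gradient (F s) x, gradient (fun y => ψ y ^ 2) x⟫)) +
          (∫ x in zSlab P 0, H (F s x) * ⟪b s x, gradient (fun y => ψ y ^ 2) x⟫) +
          ((∫ x in zSlab P 0, 2 / cylRadius x * (H (F s x) * fderiv ℝ (fun y => ψ y ^ 2) x (eR x))) +
            2 * radialConst₂ * (ψ 0 ^ 2 * ∫ z in (0 : ℝ)..P, H (F s (meridianPoint (0, z)))))) +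
        deriv η s * ∫ x in zSlab P 0, H (F s x) * ψ x ^ 2) := by
  have hψp : IsAxiallyPeriodic P ψ := periodic_of_forall_add_smul_pea hψz
  -- the window cut-off
  obtain ⟨φt, hφt⟩ : ∃ φt : EuclideanSpace ℝ (Fin 3) → ℝ, φt = fun y => ψ y * periodicWindow P (y 2) :=
    ⟨_, rfl⟩
  have hφt2 : ContDiff ℝ 2 φt := by rw [hφt]; exact contDiff_mul_comp_apply_two hψ (contDiff_periodicWindow P)
  have hφtc : HasCompactSupport φt := by
    rw [hφt]
    exact hasCompactSupport_mul_comp_apply_two hψ0 (A := 2 * P) fun z hz =>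
      abs_le_of_periodicWindow_ne_zero_pea hP z hz
  have hφta : IsAxisymmetricScalar φt := by rw [hφt]; exact isAxisymmetricScalar_mul_comp_apply_two hψa _
  have hint' : Integrable (fun p : ℝ × EuclideanSpace ℝ (Fin 3) =>
      (deriv H (F p.1 p.2) * N p.1 p.2 * η p.1 + H (F p.1 p.2) * deriv η p.1) * φt p.2 ^ 2)
      ((volume.restrict (Ioc t₁ t₂)).prod volume) := by rw [hφt]; exact hint
  have hE := energy_identity_axis_divFree ht hF2 hFa hb1 hbdiv hN heq hH hφt2 hφtc hφta hη hint'
  -- the left-hand side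
  have hL : ∫ x, (H (F t₂ x) * η t₂ - H (F t₁ x) * η t₁) * φt x ^ 2 =
      ∫ x in zSlab P 0, (H (F t₂ x) * η t₂ - H (F t₁ x) * η t₁) * ψ x ^ 2 := by
    set Q : EuclideanSpace ℝ (Fin 3) → ℝ := fun x => (H (F t₂ x) * η t₂ - H (F t₁ x) * η t₁) * ψ x ^ 2 with hQ
    have hQc : Continuous Q :=
      ((((hH.continuous.comp (hF2 t₂).continuous).mul continuous_const).sub
        ((hH.continuous.comp (hF2 t₁).continuous).mul continuous_const)).mul (hψ.continuous.pow 2))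
    have hQp : IsAxiallyPeriodic P Q := periodic_of_eZ_pea fun x => by
      simp only [hQ, periodic_apply_pea (hFp t₂), periodic_apply_pea (hFp t₁), periodic_apply_pea hψp]
    have hQ0 : ∀ x, ρ ≤ cylRadius x → Q x = 0 := fun x hx => by simp only [hQ, hψ0 x hx]; ring
    obtain ⟨h, -⟩ := integral_mul_window_sq_eq_and_deriv_eq_zero hP hQc hQp hQ0
    rw [← h]
    refine integral_congr_ae (Eventually.of_forall fun x => ?_)
    simp only [hQ, hφt]
    ring
  rw [← hL, hE]
  -- the right-hand side, term by term, for every `s`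
  refine intervalIntegral.integral_congr fun s _ => ?_
  have hV := viscous_window_eq hP (hF2 s) (hFp s) hH hψ hψz hψ0
  have hD := drift_window_eq hP (hF2 s) (hFp s) (hb1 s).continuous (hbp s) hH hψ hψz hψ0
  have hA := axis_window_eq hP (hF2 s) (hFp s) hH hψ hψz hρ' hψ1 hψ0 ha haz hψg
  have hB := axisBoundary_window_eq (H := H) hP (hF2 s).continuous (hFp s) hH.continuous hψz
  have hM := integral_comp_mul_windowSq_eq (H := H) hP (hF2 s).continuous (hFp s) hH.continuous
    hψ.continuous hψz hψ0
  simp only [hφt]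
  rw [hV, hD, hA, hB, hM]

end Periodic

end LeiRenZhang2019

end Literature.Analysis.FluidPDE

end
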